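import Literature.Algebra.Homology.DiscreteRepTrivialDuality
import Literature.Algebra.Homology.DiscreteRepCoindPresentation
import HarnessLib

/-!
# Tate's duality theorem for a class-formation-like object of `C_Γ` (Milne ADT I Thm. 1.8 (a)(b),
# Harari Thm. 16.21), in `Ext` language: `α²(Γ, M)` and `α¹(Γ, M)` are bijective and
# `Ext³_{C_Γ}(M, C) = 0` for every FINITE discrete `Γ`-module `M`

Topic `Algebra/Homology`; namespace `Literature.Algebra.Homology.DiscreteRep`.  One definition with
body (`invAt`, the local invariant map `inv ∘ cores_U` at an open normal subgroup), one `Prop`-valued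
structure (`TateDualityHypotheses`, the class-formation data) and theorems; no named fact, no `sorry`.
Assembles `ExtDualityLadder` (the five-lemma ladder (1.9.1)), `DiscreteRepShapiroPairing` (its
Shapiro column), `DiscreteRepTrivialDuality` (Stage 1: trivial modules) and
`DiscreteRepCoindPresentation` (`0 → M → Coind_U Res_U M → M'' → 0`).

THE STATEMENT IN PRINT.  Milne ADT I Thm. 1.8: for a class formation `(G, C)` and a finitely
generated `G`-module `M`, (a) `α^r(G, M) : Extʳ_G(M, C) → H^{2−r}(G, M)^*` is bijective for `r ≥ 2`
(and `Extʳ_G(M, C) = 0` for `r ≥ 3`); (b) `α¹(G, M)` is bijective for all `M` if `α¹(U, ℤ/mℤ)` is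
bijective for all open `U` and all `m`.  Here, for `Γ` profinite, `C ∈ C_Γ = DiscreteRepCat ℤ Γ`,
`inv : Ext²_{C_Γ}(ℤ, C) →+ Q` (`Q` an injective `ℤ`-module) and the hypotheses
`TateDualityHypotheses C inv` — for every open normal `U ≤ Γ`: `inv_U := inv ∘ cores_U` bijective on
`Ext²_U(ℤ, Res C)`, `Ext¹_U(ℤ, Res C) = 0`, `Ext¹_U(ℤ, ℤ) = 0`, `Extʳ_U(ℤ, Res C) = 0` for `r ≥ 3`,
Milne's (b) `α¹(U, ℤ/m)` bijective; and Lemma 1.9's `Extʳ_Γ(M, C) = 0` for `r ≥ 4`, `M` finite —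
the conclusion **`tateDuality_finite`**: for every `M ∈ C_Γ` with finitely many vectors,
`α²(Γ, M)` and `α¹(Γ, M)` are bijective and `Ext³_{C_Γ}(M, C) = 0`
(`α^r = ExtDuality.adjointMap inv M : Extʳ(M, C) → Hom(Ext²⁻ʳ(ℤ, M), Q)`, the Yoneda pairing).

PROOF (Milne's, p. 22): choose `U` open normal acting trivially on `M` (`M` finite, `Γ` profinite);
the short exact `0 → M → M_* → M'' → 0`, `M_* = Coind_U Res_U M` (both finite); the column
`α^r(Γ, M_*) = α^r(U, Res_U M)` (Shapiro, `DiscreteRepShapiroPairing`) with `Res_U M ≅ triv_U M`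
(Stage 1, `tateDuality_triv`); then the ladder: `Ext³ = 0` (vanishing row), `α²` surjective for all
finite `M`, `α²` injective (edge lemma, uses `α²(M'')` surjective and `Ext³(M'') = 0`), `α¹` surjective
(uses `α²(M'')` surjective, `α²(M_*)` injective), `α¹` injective (uses `α¹(M'')` surjective,
`α²(M'')` injective).  No induction is needed: each universal statement is applied to `M''`.

Written for Route A of the Poitou–Tate programme of crux `stmt-BirchSwinnertonDyer-19295` (cell
`bsd-schneider-ideate`, seat door-c4 gen 15): with `(Γ, C) = (Γ_K, C̄)` (the idèle class formation,
door-c5/door-c6) and `M = M^D` finite, the injectivity of `α¹(Γ_K, M^D)` is the input of Milne I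
Thm. 4.10 (b) `Ker γ¹ ⊆ Im β¹` (= the named fact `poitouTate_selmerStructure_duality`, hE).
HONEST FRAMING: homological algebra only — the class-formation hypotheses are NOT discharged here;
no arithmetic statement and no case of BSD is proved.

## References
* J. S. Milne, *Arithmetic Duality Theorems* (2nd ed. 2006), I §1, Theorem 1.8 and its proof
  (pp. 21–23), Lemma 1.9. [MilneADT2006]
* D. Harari, *Galois Cohomology and Class Field Theory*, Universitext (2020), §16.3, Lemma 16.19 –
  Theorem 16.21 (pp. 274–276). [Harari2020]
-/

noncomputable section

namespace Literature.Algebra.Homology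

namespace DiscreteRep

open CategoryTheory CategoryTheory.Limits CategoryTheory.Abelian ExtDuality

/-! ## §0 Stage 1 for an arbitrary `ℤ`-module structure -/

/-- `tateDuality_triv` for an arbitrary `Module ℤ` instance on `A` (all such instances coincide).
[cite: MilneADT2006, I Theorem 1.8 (proof)] -/
theorem tateDuality_triv_inst {Δ : Type} [Group Δ] [TopologicalSpace Δ] [IsTopologicalGroup Δ]
    (C : DiscreteRepCat ℤ Δ) {Q : Type} [AddCommGroup Q] (inv : Ext (triv (k := ℤ) (Γ := Δ) ℤ) C 2 →+ Q)
    (hQ : Module.Baer ℤ Q) (hinv : Function.Bijective inv)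
    (h1C : ∀ x : Ext (triv (k := ℤ) (Γ := Δ) ℤ) C 1, x = 0)
    (h1P : ∀ y : Ext (triv (k := ℤ) (Γ := Δ) ℤ) (triv (k := ℤ) (Γ := Δ) ℤ) 1, y = 0)
    (h3 : ∀ r, 3 ≤ r → ∀ x : Ext (triv (k := ℤ) (Γ := Δ) ℤ) C r, x = 0)
    (hb : ∀ m : ℕ, 0 < m →
      AdjointBijective inv (triv (k := ℤ) (Γ := Δ) (ZMod m)) (show 1 + 1 = 2 from rfl))
    (A : Type) [AddCommGroup A] [inst : Module ℤ A] [AddGroup.FG A] :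
    AdjointBijective inv (triv (k := ℤ) (Γ := Δ) A) (show 0 + 2 = 2 from rfl) ∧
      AdjointBijective inv (triv (k := ℤ) (Γ := Δ) A) (show 1 + 1 = 2 from rfl) ∧
      ∀ r, 3 ≤ r → ∀ x : Ext (triv (k := ℤ) (Γ := Δ) A) C r, x = 0 := by
  obtain rfl : inst = AddCommGroup.toIntModule A := Subsingleton.elim _ _
  exact tateDuality_triv C inv hQ hinv h1C h1P h3 hb A

/-! ## §1 The class-formation data -/

section Setting

variable {Γ : Type} [Group Γ] [TopologicalSpace Γ] [IsTopologicalGroup Γ] [CompactSpace Γ]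
  [TotallyDisconnectedSpace Γ] (C : DiscreteRepCat ℤ Γ) {Q : Type} [AddCommGroup Q]
  (inv : Ext (triv (k := ℤ) (Γ := Γ) ℤ) C 2 →+ Q)

/-- **The local invariant map at an open normal subgroup**: `inv_U := inv ∘ cores_U :
Ext²_{C_U}(ℤ, Res_U C) →+ Q` (the class-formation normalisation `inv_U = inv_Γ ∘ Cor`).
[cite: MilneADT2006, I §1 (class formations, (1.1))][cite: Harari2020, §16.1 Definition 16.3] -/
def invAt (U : OpenNormalSubgroup Γ) :
    Ext (triv (k := ℤ) (Γ := (U : Subgroup Γ)) ℤ) ((resD ℤ (U : Subgroup Γ)).obj C) 2 →+ Q :=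
  haveI := finiteIndex_of_openNormalSubgroup U
  inv.comp (extCores (U : Subgroup Γ) U.toOpenSubgroup.isOpen C 2)

omit [TotallyDisconnectedSpace Γ] in
/-- `invAt` versus `inv.comp (extCores …)` on the duality predicates (definitional).
[cite: Harari2020, Proposition 16.18] -/
theorem adjointBijective_invAt_iff (U : OpenNormalSubgroup Γ) (N : DiscreteRepCat ℤ (U : Subgroup Γ))
    {r s : ℕ} (h : s + r = 2) :
    haveI := finiteIndex_of_openNormalSubgroup U
    AdjointBijective (inv.comp (extCores (U : Subgroup Γ) U.toOpenSubgroup.isOpen C 2)) N h ↔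
      AdjointBijective (invAt C inv U) N h :=
  Iff.rfl

/-- **The hypotheses of Tate's duality theorem** for `(Γ, C, inv)`: at every open normal subgroup
`U` (a class formation restricts to one on `U`): `inv_U` bijective (`H²(U, C) ≅ ℚ/ℤ`),
`Ext¹_U(ℤ, C) = 0` (`H¹(U, C) = 0`), `Ext¹_U(ℤ, ℤ) = 0` (`H¹(U, ℤ) = Hom(U, ℤ) = 0`),
`Extʳ_U(ℤ, C) = 0` for `r ≥ 3` (Lemma 1.9 with `M = ℤ`), Milne's hypothesis (b) `α¹(U, ℤ/m)`
bijective; and Lemma 1.9 over `Γ`: `Extʳ_Γ(M, C) = 0` for `r ≥ 4` and `M` finite.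
[cite: MilneADT2006, I Theorem 1.8, Lemma 1.9][cite: Harari2020, §16.3 Theorem 16.21] -/
structure TateDualityHypotheses : Prop where
  /-- `Q` is an injective `ℤ`-module. -/
  baer : Module.Baer ℤ Q
  /-- `inv_U` is bijective. -/
  invAt_bijective : ∀ U : OpenNormalSubgroup Γ, Function.Bijective (invAt C inv U)
  /-- `Ext¹_U(ℤ, Res C) = 0`. -/
  ext_one_eq_zero : ∀ (U : OpenNormalSubgroup Γ)
    (x : Ext (triv (k := ℤ) (Γ := (U : Subgroup Γ)) ℤ) ((resD ℤ (U : Subgroup Γ)).obj C) 1), x = 0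
  /-- `Ext¹_U(ℤ, ℤ) = 0`. -/
  ext_one_triv_eq_zero : ∀ (U : OpenNormalSubgroup Γ)
    (y : Ext (triv (k := ℤ) (Γ := (U : Subgroup Γ)) ℤ) (triv (k := ℤ) (Γ := (U : Subgroup Γ)) ℤ) 1), y = 0
  /-- `Extʳ_U(ℤ, Res C) = 0` for `r ≥ 3`. -/
  ext_triv_eq_zero_of_three_le : ∀ (U : OpenNormalSubgroup Γ) (r : ℕ), 3 ≤ r →
    ∀ x : Ext (triv (k := ℤ) (Γ := (U : Subgroup Γ)) ℤ) ((resD ℤ (U : Subgroup Γ)).obj C) r, x = 0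
  /-- Milne's hypothesis (b): `α¹(U, ℤ/m)` bijective. -/
  adjointBijective_one_zmod : ∀ (U : OpenNormalSubgroup Γ) (m : ℕ), 0 < m →
    AdjointBijective (invAt C inv U) (triv (k := ℤ) (Γ := (U : Subgroup Γ)) (ZMod m))
      (show 1 + 1 = 2 from rfl)
  /-- Lemma 1.9: `Extʳ_Γ(M, C) = 0` for `r ≥ 4`, `M` finite. -/
  ext_eq_zero_of_four_le : ∀ (M : DiscreteRepCat ℤ Γ), Finite M.obj.V → ∀ r : ℕ, 4 ≤ r →
    ∀ x : Ext M C r, x = 0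

variable {C inv}

/-! ## §2 The column `α^r(Γ, Coind_U Res_U M) = α^r(U, Res_U M)` for `U` acting trivially on `M` -/

omit [TotallyDisconnectedSpace Γ] in
/-- **The middle column of (1.9.1)**: for `M` finite and `U` open normal acting trivially on `M`,
`α²(Γ, M_*)` and `α¹(Γ, M_*)` are bijective and `Ext³(M_*, C) = 0`, `M_* = Coind_U Res_U M`
(Shapiro + Stage 1 on `Res_U M ≅ triv_U M`).
[cite: MilneADT2006, I Theorem 1.8 (proof, (1.9.1))][cite: Harari2020, Proposition 16.18] -/
theorem column_coindRes (hyp : TateDualityHypotheses C inv) (M : DiscreteRepCat ℤ Γ) [Finite M.obj.V]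
    (U : OpenNormalSubgroup Γ) (hUM : ∀ u : Γ, u ∈ (U : Subgroup Γ) → ∀ x : M.obj.V, M.obj.ρ u x = x) :
    haveI := finiteIndex_of_openNormalSubgroup U
    AdjointBijective inv ((coindD ℤ (U : Subgroup Γ) U.toOpenSubgroup.isOpen).obj
        ((resD ℤ (U : Subgroup Γ)).obj M)) (show 0 + 2 = 2 from rfl) ∧
      AdjointBijective inv ((coindD ℤ (U : Subgroup Γ) U.toOpenSubgroup.isOpen).obj
        ((resD ℤ (U : Subgroup Γ)).obj M)) (show 1 + 1 = 2 from rfl) ∧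
      ∀ x : Ext ((coindD ℤ (U : Subgroup Γ) U.toOpenSubgroup.isOpen).obj
        ((resD ℤ (U : Subgroup Γ)).obj M)) C 3, x = 0 := by
  haveI := finiteIndex_of_openNormalSubgroup U
  haveI : AddGroup.FG M.obj.V := inferInstance
  -- Stage 1 for the open subgroup `U`, on the trivial module `M.V`
  have st := tateDuality_triv_inst ((resD ℤ (U : Subgroup Γ)).obj C) (invAt C inv U) hyp.baer
    (hyp.invAt_bijective U) (hyp.ext_one_eq_zero U) (hyp.ext_one_triv_eq_zero U)
    (hyp.ext_triv_eq_zero_of_three_le U) (hyp.adjointBijective_one_zmod U) M.obj.V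
    (inst := M.obj.hV2)
  -- transport along `Res_U M ≅ triv_U M.V`
  let e := resTrivIso (k := ℤ) (U : Subgroup Γ) M hUM
  have r2 : AdjointBijective (invAt C inv U) ((resD ℤ (U : Subgroup Γ)).obj M)
      (show 0 + 2 = 2 from rfl) := (adjointBijective_iff_of_iso (invAt C inv U) e _).2 st.1
  have r1 : AdjointBijective (invAt C inv U) ((resD ℤ (U : Subgroup Γ)).obj M)
      (show 1 + 1 = 2 from rfl) := (adjointBijective_iff_of_iso (invAt C inv U) e _).2 st.2.1
  have v3 : ∀ y : Ext ((resD ℤ (U : Subgroup Γ)).obj M) ((resD ℤ (U : Subgroup Γ)).obj C) 3, y = 0 :=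
    fun y => ext_eq_zero_of_iso e (st.2.2 3 le_rfl) y
  -- Shapiro
  refine ⟨(adjointBijective_coind_iff (U : Subgroup Γ) U.toOpenSubgroup.isOpen C inv _ _).2
      ((adjointBijective_invAt_iff C inv U _ _).2 r2),
    (adjointBijective_coind_iff (U : Subgroup Γ) U.toOpenSubgroup.isOpen C inv _ _).2
      ((adjointBijective_invAt_iff C inv U _ _).2 r1), fun x => ?_⟩
  have Sh := ExtAdjunction.extAdjunctionAddEquiv (coindResAdj (U : Subgroup Γ) U.toOpenSubgroup.isOpen)
    ((resD ℤ (U : Subgroup Γ)).obj M) C 3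
  exact (AddEquiv.map_eq_zero_iff Sh).1 (v3 (Sh x))

/-! ## §3 The theorem -/

/-- **`Ext³_{C_Γ}(M, C) = 0` for `M` finite** (row `r = 3` of (1.9.1): `Ext³(M_*) = 0` by the column,
`Ext⁴(M'') = 0` by Lemma 1.9). [cite: MilneADT2006, I Theorem 1.8 (proof)] -/
theorem ext_three_eq_zero (hyp : TateDualityHypotheses C inv) (M : DiscreteRepCat ℤ Γ)
    [Finite M.obj.V] (x : Ext M C 3) : x = 0 := by
  obtain ⟨U, hUM⟩ := exists_openNormalSubgroup_forall_apply_eq (k := ℤ) M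
  haveI := finiteIndex_of_openNormalSubgroup U
  have hS := coindResSC_shortExact (k := ℤ) (U : Subgroup Γ) U.toOpenSubgroup.isOpen M
  haveI : Finite (coindResSC (k := ℤ) (U : Subgroup Γ) U.toOpenSubgroup.isOpen M).X₃.obj.V :=
    finite_coindResCokernel (U : Subgroup Γ) U.toOpenSubgroup.isOpen M hUM
  have col := column_coindRes hyp M U hUM
  exact ext_eq_zero_of_ladder₁ hS C (show 1 + 3 = 4 from rfl) col.2.2
    (hyp.ext_eq_zero_of_four_le _ inferInstance 4 le_rfl) x

/-- **`α²(Γ, M)` is surjective for `M` finite** (edge lemma: needs only `α²(Γ, M_*)` surjective).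
[cite: MilneADT2006, I Theorem 1.8 (proof)] -/
theorem adjointSurjective_two (hyp : TateDualityHypotheses C inv) (M : DiscreteRepCat ℤ Γ)
    [Finite M.obj.V] : AdjointSurjective inv M (show 0 + 2 = 2 from rfl) := by
  obtain ⟨U, hUM⟩ := exists_openNormalSubgroup_forall_apply_eq (k := ℤ) M
  haveI := finiteIndex_of_openNormalSubgroup U
  have hS := coindResSC_shortExact (k := ℤ) (U : Subgroup Γ) U.toOpenSubgroup.isOpen M
  have col := column_coindRes hyp M U hUM
  exact adjointSurjective_two_of_ladder inv hS hyp.baer _ rfl col.1.2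

/-- **`α²(Γ, M)` is injective for `M` finite** (edge lemma: `α²(M'')` surjective, `α²(M_*)` injective,
`Ext³(M'') = 0`). [cite: MilneADT2006, I Theorem 1.8 (proof)] -/
theorem adjointInjective_two (hyp : TateDualityHypotheses C inv) (M : DiscreteRepCat ℤ Γ)
    [Finite M.obj.V] : AdjointInjective inv M (show 0 + 2 = 2 from rfl) := by
  obtain ⟨U, hUM⟩ := exists_openNormalSubgroup_forall_apply_eq (k := ℤ) M
  haveI := finiteIndex_of_openNormalSubgroup U
  have hS := coindResSC_shortExact (k := ℤ) (U : Subgroup Γ) U.toOpenSubgroup.isOpen M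
  haveI : Finite (coindResSC (k := ℤ) (U : Subgroup Γ) U.toOpenSubgroup.isOpen M).X₃.obj.V :=
    finite_coindResCokernel (U : Subgroup Γ) U.toOpenSubgroup.isOpen M hUM
  have col := column_coindRes hyp M U hUM
  exact adjointInjective_two_of_ladder inv hS hyp.baer _ rfl (adjointSurjective_two hyp _) col.1.1
    (fun x => ext_three_eq_zero hyp _ x)

/-- **`α¹(Γ, M)` is surjective for `M` finite** (`α¹(M_*)` surjective, `α²(M'')` surjective,
`α²(M_*)` injective). [cite: MilneADT2006, I Theorem 1.8 (proof, (b))] -/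
theorem adjointSurjective_one (hyp : TateDualityHypotheses C inv) (M : DiscreteRepCat ℤ Γ)
    [Finite M.obj.V] : AdjointSurjective inv M (show 1 + 1 = 2 from rfl) := by
  obtain ⟨U, hUM⟩ := exists_openNormalSubgroup_forall_apply_eq (k := ℤ) M
  haveI := finiteIndex_of_openNormalSubgroup U
  have hS := coindResSC_shortExact (k := ℤ) (U : Subgroup Γ) U.toOpenSubgroup.isOpen M
  haveI : Finite (coindResSC (k := ℤ) (U : Subgroup Γ) U.toOpenSubgroup.isOpen M).X₃.obj.V :=
    finite_coindResCokernel (U : Subgroup Γ) U.toOpenSubgroup.isOpen M hUM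
  have col := column_coindRes hyp M U hUM
  exact adjointSurjective_of_ladder inv hS hyp.baer (show 1 + 1 = 2 from rfl) (show 1 + 1 = 2 from rfl)
    (show 0 + 1 = 1 from rfl) (show 0 + 2 = 2 from rfl) col.2.1.2 (adjointSurjective_two hyp _) col.1.1

/-- **`α¹(Γ, M)` is injective for `M` finite** (`α¹(M'')` surjective, `α¹(M_*)` injective,
`α²(M'')` injective). [cite: MilneADT2006, I Theorem 1.8 (proof, (b))] -/
theorem adjointInjective_one (hyp : TateDualityHypotheses C inv) (M : DiscreteRepCat ℤ Γ)
    [Finite M.obj.V] : AdjointInjective inv M (show 1 + 1 = 2 from rfl) := by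
  obtain ⟨U, hUM⟩ := exists_openNormalSubgroup_forall_apply_eq (k := ℤ) M
  haveI := finiteIndex_of_openNormalSubgroup U
  have hS := coindResSC_shortExact (k := ℤ) (U : Subgroup Γ) U.toOpenSubgroup.isOpen M
  haveI : Finite (coindResSC (k := ℤ) (U : Subgroup Γ) U.toOpenSubgroup.isOpen M).X₃.obj.V :=
    finite_coindResCokernel (U : Subgroup Γ) U.toOpenSubgroup.isOpen M hUM
  have col := column_coindRes hyp M U hUM
  exact adjointInjective_of_ladder inv hS hyp.baer (show 1 + 1 = 2 from rfl) (show 1 + 1 = 2 from rfl)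
    (show 0 + 1 = 1 from rfl) (show 0 + 2 = 2 from rfl) (adjointSurjective_one hyp _) col.2.1.1
    (adjointInjective_two hyp _)

/-- **Tate's duality theorem in `Ext` form (Milne ADT I Thm. 1.8 (a), (b) for finite modules).**
Let `Γ` be profinite, `C ∈ C_Γ`, `inv : Ext²_{C_Γ}(ℤ, C) →+ Q` with `Q` an injective `ℤ`-module,
satisfying `TateDualityHypotheses C inv`.  Then for every `M ∈ C_Γ` with finitely many vectors the
Yoneda duality maps `α²(Γ, M) : Ext²(M, C) → Hom(Hom(ℤ, M), Q)` and
`α¹(Γ, M) : Ext¹(M, C) → Hom(Ext¹(ℤ, M), Q)` are bijective and `Ext³_{C_Γ}(M, C) = 0`.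
[cite: MilneADT2006, I Theorem 1.8][cite: Harari2020, §16.3 Theorem 16.21] -/
theorem tateDuality_finite (hyp : TateDualityHypotheses C inv) (M : DiscreteRepCat ℤ Γ) [Finite M.obj.V] :
    AdjointBijective inv M (show 0 + 2 = 2 from rfl) ∧ AdjointBijective inv M (show 1 + 1 = 2 from rfl) ∧
      ∀ x : Ext M C 3, x = 0 :=
  ⟨⟨adjointInjective_two hyp M, adjointSurjective_two hyp M⟩,
    ⟨adjointInjective_one hyp M, adjointSurjective_one hyp M⟩, ext_three_eq_zero hyp M⟩

/-- **The input of Poitou–Tate (Milne I 4.10 (b), `r = 1`)**: under the hypotheses, for `M` finite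
the map `Ext¹_{C_Γ}(M, C) → Hom(Ext¹_{C_Γ}(ℤ, M), Q)`, `x ↦ (y ↦ inv (y ∘ x))`, is INJECTIVE.
[cite: MilneADT2006, I Theorem 1.8 (b) and Theorem 4.10 (proof)] -/
theorem adjointMap_one_injective (hyp : TateDualityHypotheses C inv) (M : DiscreteRepCat ℤ Γ)
    [Finite M.obj.V] : Function.Injective (adjointMap inv M (show 1 + 1 = 2 from rfl)) :=
  adjointInjective_one hyp M

end Setting

end DiscreteRep

end Literature.Algebra.Homology
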